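import Mathlib.MeasureTheory.Function.Jacobian
import Mathlib.Topology.MetricSpace.Contracting
import Mathlib.Analysis.Calculus.MeanValue
import Literature.Algebra.Lie.ExteriorPowerTopDegreeTrace
import HarnessLib

/-!
# Crux `BlockLipschitzL` (stmt-QuantumFields-23533) ∕ `HistoryTailL` (stmt-QuantumFields-19936), LINE 25 «CompactnessTransfer»,
# stub S1″ row (M) «MONOTONICITY» — FILE α «AXIAL SHEARS»

Cell `ym3-torus` (YM ladder rung R3 = continuum SU(2) Yang–Mills on T³ — a RUNG, NOT the Clay problem: not d = 4, not
infinite volume, not a mass gap); WIDTH helper seat `ym-ust-19936-w2` g13.  Helper `--supports stmt-QuantumFields-19936`;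
THEOREMS ONLY (0 `def`, 0 `sorry`, default heartbeats); imports: Mathlib (change of variables `MeasureTheory.Function.Jacobian`,
Banach fixed point, mean value inequality), lit ✓`Literature.Algebra.Lie.ExteriorPowerTopDegreeTrace` (`det(1 + f ⊗ u) = 1 + f u`),
HarnessLib.

WHAT THIS FILE IS FOR.  The monotonicity row (M) of S1″ (w3 g15's `hMono`: `σ⁻¹·E(U; B_σ(y)) ≤ ρ⁻¹·E(U; B_ρ(y))` for
finite-energy unit `W^{1,2}` maps `Q → S³` minimising the Dirichlet energy on balls) is proved in this lane by INNER
VARIATIONS along one coordinate axis at a time: the competitor is `U ∘ Ψ⁻¹` for the AXIAL SHEAR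
`Ψ_h(z) := z − h(z) • e` (`e` a fixed vector of norm `≤ 1`, `h` a smooth compactly supported scalar function with
`‖Dh‖ ≤ L < 1`).  This file is the deformation toolkit, generic over a real normed space `E`:
* §1 the derivative `DΨ_z = id − Dh_z ⊗ e`, its explicit inverse `A_z := id + (1 − Dh_z e)⁻¹ • Dh_z ⊗ e` (Sherman–Morrison)
  and its determinant `det DΨ_z = 1 − Dh_z e` (rank-one update);
* §2 `Ψ_h` is a bijection of `E` (injective by the mean value inequality, surjective by Banach's fixed point theorem for
  the contraction `z ↦ x + h(z) • e`), equal to the identity off `tsupport h`, and maps every set containing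
  `tsupport h` onto itself (so does its inverse); preimages of compact sets are compact;
* §3 the change-of-variables identities on a `Ψ_h`-invariant measurable set `S ⊇ tsupport h`:
  `∫_S g = ∫_S (1 − Dh_z e) • g(Ψ_h z) dz` and the matching `IntegrableOn` equivalence (Mathlib's Jacobian formula with
  `|det DΨ_z| = 1 − Dh_z e > 0`).
FILE β (weak chain rule for `U ∘ Ψ⁻¹`), FILE γ (axial stationarity of ball minimisers), FILE δ (monotonicity) build on it.

HONEST SCOPE.  Elementary calculus ∕ linear algebra; nothing of (M), (C), (R), S1″, S2♭″, `hHalvingBand`, K1,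
`MeanDeviationL`, `BlockLipschitzL`, `HistoryTailL` is proved here.  YM₃ on T³ is rung R3, not Clay; YM gap NOT proved.

References: L. Simon, Theorems on Regularity and Singularity of Energy Minimizing Maps, Birkhäuser 1996 [Simon1996]
(§2.2 (v), §2.4: monotonicity via domain variations); P. Price, A monotonicity formula for Yang–Mills fields,
Manuscripta Math. 43 (1983) 131–166 [Price1983]; L. C. Evans, R. F. Gariepy, Measure Theory and Fine Properties of
Functions (1992) [EvansGariepy1992] (§3.3.3 change of variables).
-/

set_option autoImplicit false

noncomputable section

open MeasureTheory Set Function Filter Topology Metric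
open scoped NNReal

namespace Summit.QuantumFields.YangMills.Theorems.PoincareLipschitzAxialShear

variable {E : Type*} [NormedAddCommGroup E] [NormedSpace ℝ E]

/-! ## §1 The derivative of an axial shear: inverse and determinant -/

/-- **Sherman–Morrison for a rank-one update of the identity (left inverse).**  For a continuous linear form `c` and a
vector `e` with `c e ≠ 1`, `A := id + (1 − c e)⁻¹ • (c ⊗ e)` is a left inverse of `D := id − c ⊗ e`
(`(c ⊗ e) v := c v • e`). [folklore] -/
theorem inv_comp_id_sub_smulRight (c : E →L[ℝ] ℝ) (e : E) (hce : c e ≠ 1) :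
    (ContinuousLinearMap.id ℝ E + (1 - c e)⁻¹ • c.smulRight e).comp
      (ContinuousLinearMap.id ℝ E - c.smulRight e) = ContinuousLinearMap.id ℝ E := by
  have h1 : (1 - c e) ≠ 0 := sub_ne_zero.mpr (Ne.symm hce)
  ext v
  simp only [ContinuousLinearMap.comp_apply, sub_apply, ContinuousLinearMap.id_apply,
    ContinuousLinearMap.smulRight_apply, add_apply, smul_apply]
  have key : (1 - c e)⁻¹ * (c v - c v * c e) = c v := by
    field_simp
  rw [map_sub, map_smul, smul_eq_mul, smul_smul, key]
  abel

/-- **Sherman–Morrison for a rank-one update of the identity (right inverse).**  With `c e ≠ 1`,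
`(id − c ⊗ e) ∘ (id + (1 − c e)⁻¹ • (c ⊗ e)) = id`. [folklore] -/
theorem id_sub_smulRight_comp_inv (c : E →L[ℝ] ℝ) (e : E) (hce : c e ≠ 1) :
    (ContinuousLinearMap.id ℝ E - c.smulRight e).comp
      (ContinuousLinearMap.id ℝ E + (1 - c e)⁻¹ • c.smulRight e) = ContinuousLinearMap.id ℝ E := by
  have h1 : (1 - c e) ≠ 0 := sub_ne_zero.mpr (Ne.symm hce)
  ext v
  simp only [ContinuousLinearMap.comp_apply, sub_apply, ContinuousLinearMap.id_apply,
    ContinuousLinearMap.smulRight_apply, add_apply, smul_apply]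
  have key : (1 - c e)⁻¹ * c v - (c v + (1 - c e)⁻¹ * (c v * c e)) = 0 := by
    field_simp
    ring
  rw [map_add, map_smul, map_smul, smul_eq_mul, smul_eq_mul, smul_smul, add_sub_assoc, ← sub_smul, key, zero_smul,
    add_zero]

/-- **The inverse applied to a vector**: `A v = v + ((1 − c e)⁻¹ · c v) • e`. [folklore] -/
theorem inv_apply (c : E →L[ℝ] ℝ) (e v : E) :
    (ContinuousLinearMap.id ℝ E + (1 - c e)⁻¹ • c.smulRight e) v = v + ((1 - c e)⁻¹ * c v) • e := by
  simp only [add_apply, ContinuousLinearMap.id_apply, smul_apply,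
    ContinuousLinearMap.smulRight_apply, smul_smul]

/-- **`(1 − c e) • A v = (1 − c e) • v + c v • e`** — the Jacobian-weighted inverse is polynomial in `c`. [folklore] -/
theorem one_sub_smul_inv_apply (c : E →L[ℝ] ℝ) (e v : E) (hce : c e ≠ 1) :
    (1 - c e) • (ContinuousLinearMap.id ℝ E + (1 - c e)⁻¹ • c.smulRight e) v = (1 - c e) • v + c v • e := by
  have h1 : (1 - c e) ≠ 0 := sub_ne_zero.mpr (Ne.symm hce)
  rw [inv_apply, smul_add, smul_smul, ← mul_assoc, mul_inv_cancel₀ h1, one_mul]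

/-- **Determinant of a rank-one update of the identity**: `det(id − c ⊗ e) = 1 − c e` (the coordinate-free
`det(1 + f ⊗ u) = 1 + f(u)` of lit `ExteriorPowerTopDegreeTrace.det_one_add_smulRight` at `f := −c`).
[cite: BourbakiAlgebraI1989, Ch. III §8 no. 1] -/
theorem det_id_sub_smulRight [FiniteDimensional ℝ E] (c : E →L[ℝ] ℝ) (e : E) :
    (ContinuousLinearMap.id ℝ E - c.smulRight e).det = 1 - c e := by
  have h := Literature.Algebra.Lie.ExteriorPowerTopDegreeTrace.det_one_add_smulRight
    (R := ℝ) (M := E) (-(c : E →ₗ[ℝ] ℝ)) e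
  have hcoe : ((ContinuousLinearMap.id ℝ E - c.smulRight e : E →L[ℝ] E) : E →ₗ[ℝ] E) =
      1 + (-(c : E →ₗ[ℝ] ℝ)).smulRight e := by
    ext v
    simp [sub_eq_add_neg]
  change LinearMap.det ((ContinuousLinearMap.id ℝ E - c.smulRight e : E →L[ℝ] E) : E →ₗ[ℝ] E) = 1 - c e
  rw [hcoe, h, LinearMap.neg_apply, ContinuousLinearMap.coe_coe, ← sub_eq_add_neg]

/-! ## §2 The axial shear `Ψ_h z := z − h z • e` -/

variable {h : E → ℝ} {e : E} {L : ℝ}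

/-- **Lipschitz bound on `h` from the derivative bound** (mean value inequality on the convex set `E`).
[cite: EvansGariepy1992, §3.1] -/
theorem abs_sub_le_of_fderiv_le (hd : Differentiable ℝ h) (hL : ∀ z, ‖fderiv ℝ h z‖ ≤ L) (z z' : E) :
    |h z - h z'| ≤ L * ‖z - z'‖ := by
  have := Convex.norm_image_sub_le_of_norm_fderiv_le (f := h) (s := Set.univ) (fun x _ => hd x)
    (fun x _ => hL x) convex_univ (mem_univ z') (mem_univ z)
  simpa [Real.norm_eq_abs] using this

/-- **The shear moves points by at most `L·‖z − z′‖` relative to each other**: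
`(1 − L)·‖z − z′‖ ≤ ‖Ψ_h z − Ψ_h z′‖`. [folklore] -/
theorem norm_sub_le_norm_shear_sub (hd : Differentiable ℝ h) (hL : ∀ z, ‖fderiv ℝ h z‖ ≤ L) (he : ‖e‖ ≤ 1)
    (z z' : E) : (1 - L) * ‖z - z'‖ ≤ ‖(z - h z • e) - (z' - h z' • e)‖ := by
  have h1 : (z - h z • e) - (z' - h z' • e) = (z - z') - (h z - h z') • e := by
    rw [sub_smul]; abel
  have h2 : ‖(h z - h z') • e‖ ≤ L * ‖z - z'‖ := by
    rw [norm_smul, Real.norm_eq_abs]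
    calc |h z - h z'| * ‖e‖ ≤ |h z - h z'| * 1 := by gcongr
      _ ≤ L * ‖z - z'‖ := by rw [mul_one]; exact abs_sub_le_of_fderiv_le hd hL z z'
  rw [h1]
  have h3 := norm_sub_norm_le (z - z') ((h z - h z') • e)
  linarith

/-- **The axial shear is injective** (`L < 1`). [folklore] -/
theorem shear_injective (hd : Differentiable ℝ h) (hL : ∀ z, ‖fderiv ℝ h z‖ ≤ L) (he : ‖e‖ ≤ 1) (hL1 : L < 1) :
    Injective (fun z : E => z - h z • e) := by
  intro z z' hzz
  have h1 := norm_sub_le_norm_shear_sub hd hL he z z'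
  have h2 : (z - h z • e) - (z' - h z' • e) = 0 := sub_eq_zero.mpr hzz
  rw [h2, norm_zero] at h1
  have h3 : ‖z - z'‖ ≤ 0 := by
    by_contra hlt
    push Not at hlt
    have : 0 < (1 - L) * ‖z - z'‖ := mul_pos (by linarith) hlt
    linarith
  exact sub_eq_zero.mp (norm_le_zero_iff.mp h3)

/-- **The axial shear is surjective** (`0 ≤ L < 1`, `E` complete): `x = Ψ_h z` for the fixed point `z` of the
contraction `z ↦ x + h z • e` (Banach). [folklore] -/
theorem shear_surjective [CompleteSpace E] (hd : Differentiable ℝ h) (hL : ∀ z, ‖fderiv ℝ h z‖ ≤ L)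
    (he : ‖e‖ ≤ 1) (hL0 : 0 ≤ L) (hL1 : L < 1) : Surjective (fun z : E => z - h z • e) := by
  intro x
  have hT : ContractingWith ⟨L, hL0⟩ (fun z : E => x + h z • e) := by
    have hlip : ∀ z z' : E, dist (x + h z • e) (x + h z' • e) ≤ L * dist z z' := by
      intro z z'
      rw [dist_eq_norm, dist_eq_norm, add_sub_add_left_eq_sub, ← sub_smul, norm_smul, Real.norm_eq_abs]
      calc |h z - h z'| * ‖e‖ ≤ |h z - h z'| * 1 := by gcongr
        _ ≤ L * ‖z - z'‖ := by rw [mul_one]; exact abs_sub_le_of_fderiv_le hd hL z z'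
    exact ⟨by exact_mod_cast hL1, LipschitzWith.of_dist_le_mul fun z z' => hlip z z'⟩
  haveI : Nonempty E := ⟨x⟩
  refine ⟨ContractingWith.fixedPoint _ hT, ?_⟩
  have hfix : x + h (ContractingWith.fixedPoint _ hT) • e = ContractingWith.fixedPoint _ hT :=
    hT.fixedPoint_isFixedPt
  calc ContractingWith.fixedPoint _ hT - h (ContractingWith.fixedPoint _ hT) • e
      = (x + h (ContractingWith.fixedPoint _ hT) • e) - h (ContractingWith.fixedPoint _ hT) • e := by
        rw [hfix]
    _ = x := add_sub_cancel_right x _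

/-- **The axial shear is a bijection of `E`** (`0 ≤ L < 1`). [folklore] -/
theorem shear_bijective [CompleteSpace E] (hd : Differentiable ℝ h) (hL : ∀ z, ‖fderiv ℝ h z‖ ≤ L)
    (he : ‖e‖ ≤ 1) (hL0 : 0 ≤ L) (hL1 : L < 1) : Bijective (fun z : E => z - h z • e) :=
  ⟨shear_injective hd hL he hL1, shear_surjective hd hL he hL0 hL1⟩

/-- **The axial shear has a two-sided inverse** `Φ` (`Φ (Ψ_h z) = z`, `Ψ_h (Φ x) = x`). [folklore] -/
theorem exists_inverse [CompleteSpace E] (hd : Differentiable ℝ h) (hL : ∀ z, ‖fderiv ℝ h z‖ ≤ L)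
    (he : ‖e‖ ≤ 1) (hL0 : 0 ≤ L) (hL1 : L < 1) :
    ∃ Φ : E → E, LeftInverse Φ (fun z : E => z - h z • e) ∧ RightInverse Φ (fun z : E => z - h z • e) :=
  Function.bijective_iff_has_inverse.mp (shear_bijective hd hL he hL0 hL1)

/-- **The shear is the identity off the support of `h`.** [folklore] -/
theorem shear_eq_self {z : E} (hz : z ∉ tsupport h) : z - h z • e = z := by
  rw [image_eq_zero_of_notMem_tsupport hz, zero_smul, sub_zero]

/-- **So is its inverse.** [folklore] -/
theorem inverse_eq_self {Φ : E → E} (hΦ : LeftInverse Φ (fun z : E => z - h z • e)) {z : E}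
    (hz : z ∉ tsupport h) : Φ z = z := by
  have := hΦ z
  simp only at this
  rwa [shear_eq_self hz] at this

/-- **Preimages**: `Ψ_h⁻¹(K) ⊆ K ∪ tsupport h`. [folklore] -/
theorem preimage_subset_union (K : Set E) : (fun z : E => z - h z • e) ⁻¹' K ⊆ K ∪ tsupport h := by
  intro z hz
  by_cases hzs : z ∈ tsupport h
  · exact Or.inr hzs
  · left
    have : z - h z • e ∈ K := hz
    rwa [shear_eq_self hzs] at this

/-- **A set containing `tsupport h` is its own preimage under an injective shear.** [folklore] -/
theorem preimage_eq_of_tsupport_subset (hinj : Injective (fun z : E => z - h z • e)) {S : Set E}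
    (hS : tsupport h ⊆ S) : (fun z : E => z - h z • e) ⁻¹' S = S := by
  ext z
  simp only [mem_preimage]
  by_cases hzs : z ∈ tsupport h
  · refine ⟨fun _ => hS hzs, fun _ => ?_⟩
    by_contra hout
    have hout' : z - h z • e ∉ tsupport h := fun hin => hout (hS hin)
    have hfix : (z - h z • e) - h (z - h z • e) • e = z - h z • e := shear_eq_self hout'
    have hzz : z - h z • e = z := hinj hfix
    exact hout (by rw [hzz]; exact hS hzs)
  · rw [shear_eq_self hzs]

/-- **A set containing `tsupport h` is its own image under a bijective shear.** [folklore] -/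
theorem image_eq_of_tsupport_subset (hbij : Bijective (fun z : E => z - h z • e)) {S : Set E}
    (hS : tsupport h ⊆ S) : (fun z : E => z - h z • e) '' S = S := by
  conv_lhs => rw [← preimage_eq_of_tsupport_subset hbij.1 hS]
  exact image_preimage_eq S hbij.2

/-- **… and its own image under the inverse shear.** [folklore] -/
theorem inverse_image_eq_of_tsupport_subset {Φ : E → E} (hΦl : LeftInverse Φ (fun z : E => z - h z • e))
    (hΦr : RightInverse Φ (fun z : E => z - h z • e)) {S : Set E} (hS : tsupport h ⊆ S) : Φ '' S = S := by
  rw [image_eq_preimage_of_inverse hΦr hΦl]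
  exact preimage_eq_of_tsupport_subset hΦl.injective hS

/-- **The inverse shear maps a set containing `tsupport h` into itself.** [folklore] -/
theorem inverse_mem_of_tsupport_subset {Φ : E → E} (hΦl : LeftInverse Φ (fun z : E => z - h z • e))
    (hΦr : RightInverse Φ (fun z : E => z - h z • e)) {S : Set E} (hS : tsupport h ⊆ S) {x : E} (hx : x ∈ S) :
    Φ x ∈ S := by
  have : Φ x ∈ Φ '' S := mem_image_of_mem Φ hx
  rwa [inverse_image_eq_of_tsupport_subset hΦl hΦr hS] at this

/-- **The shear maps a set containing `tsupport h` into itself.** [folklore] -/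
theorem shear_mem_of_tsupport_subset (hinj : Injective (fun z : E => z - h z • e)) {S : Set E}
    (hS : tsupport h ⊆ S) {z : E} (hz : z ∈ S) : z - h z • e ∈ S := by
  have : z ∈ (fun z : E => z - h z • e) ⁻¹' S := by rw [preimage_eq_of_tsupport_subset hinj hS]; exact hz
  exact this

/-- **The shear is continuous** (for continuous `h`). [folklore] -/
theorem continuous_shear (hc : Continuous h) : Continuous (fun z : E => z - h z • e) :=
  continuous_id.sub (hc.smul continuous_const)

/-- **Preimages of compact sets under the shear are compact** (`h` continuous with compact support, `E` proper).
[folklore] -/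
theorem isCompact_preimage_shear [ProperSpace E] (hc : Continuous h) (hh : HasCompactSupport h) {K : Set E}
    (hK : IsCompact K) : IsCompact ((fun z : E => z - h z • e) ⁻¹' K) :=
  (hK.union hh).of_isClosed_subset (hK.isClosed.preimage (continuous_shear hc)) (preimage_subset_union K)

/-- **The derivative of the shear**: `DΨ_z = id − Dh_z ⊗ e`. [folklore] -/
theorem hasFDerivAt_shear {z : E} (hd : DifferentiableAt ℝ h z) :
    HasFDerivAt (fun z : E => z - h z • e) (ContinuousLinearMap.id ℝ E - (fderiv ℝ h z).smulRight e) z :=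
  (hasFDerivAt_id z).sub (hd.hasFDerivAt.smul_const e)

/-- **The Jacobian is positive**: `|Dh_z e| ≤ L < 1`, so `0 < 1 − Dh_z e`. [folklore] -/
theorem one_sub_fderiv_pos {z : E} (hL : ‖fderiv ℝ h z‖ ≤ L) (he : ‖e‖ ≤ 1) (hL1 : L < 1) :
    0 < 1 - fderiv ℝ h z e := by
  have h1 : ‖fderiv ℝ h z e‖ ≤ L * ‖e‖ := (fderiv ℝ h z).le_of_opNorm_le hL e
  have hL0 : 0 ≤ L := (norm_nonneg _).trans hL
  have h2 : L * ‖e‖ ≤ L := by nlinarith [norm_nonneg e]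
  rw [Real.norm_eq_abs] at h1
  have h3 : fderiv ℝ h z e ≤ L := (le_abs_self _).trans (h1.trans h2)
  linarith

/-- **`Dh_z e ≠ 1`.** [folklore] -/
theorem fderiv_apply_ne_one {z : E} (hL : ‖fderiv ℝ h z‖ ≤ L) (he : ‖e‖ ≤ 1) (hL1 : L < 1) :
    fderiv ℝ h z e ≠ 1 := by
  have := one_sub_fderiv_pos hL he hL1
  intro h1; rw [h1, sub_self] at this; exact lt_irrefl 0 this

/-- **The absolute Jacobian of the shear is `1 − Dh_z e`.** [folklore] -/
theorem abs_det_fderiv_shear [FiniteDimensional ℝ E] {z : E} (hL : ‖fderiv ℝ h z‖ ≤ L) (he : ‖e‖ ≤ 1)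
    (hL1 : L < 1) : |(ContinuousLinearMap.id ℝ E - (fderiv ℝ h z).smulRight e).det| = 1 - fderiv ℝ h z e := by
  rw [det_id_sub_smulRight]
  exact abs_of_pos (one_sub_fderiv_pos hL he hL1)

/-! ## §3 Change of variables on a shear-invariant set -/

variable [MeasurableSpace E] [BorelSpace E] [FiniteDimensional ℝ E] (μ : Measure E) [μ.IsAddHaarMeasure]

/-- **Change of variables under the axial shear on an invariant set**: for a measurable `S ⊇ tsupport h`,
`∫_S g = ∫_S (1 − Dh_z e) • g(Ψ_h z) dz`. [cite: EvansGariepy1992, §3.3.3 Theorem 2] -/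
theorem setIntegral_eq_setIntegral_shear {F : Type*} [NormedAddCommGroup F] [NormedSpace ℝ F]
    (hd : Differentiable ℝ h) (hL : ∀ z, ‖fderiv ℝ h z‖ ≤ L) (he : ‖e‖ ≤ 1) (hL1 : L < 1)
    {S : Set E} (hSm : MeasurableSet S) (hS : tsupport h ⊆ S) (g : E → F) :
    ∫ x in S, g x ∂μ = ∫ z in S, (1 - fderiv ℝ h z e) • g (z - h z • e) ∂μ := by
  haveI : CompleteSpace E := FiniteDimensional.complete ℝ E
  have hL0 : 0 ≤ L := (norm_nonneg _).trans (hL 0)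
  have hbij := shear_bijective hd hL he hL0 hL1
  have h1 := integral_image_eq_integral_abs_det_fderiv_smul μ hSm
    (fun z _ => (hasFDerivAt_shear (hd z)).hasFDerivWithinAt) hbij.1.injOn g
  rw [image_eq_of_tsupport_subset hbij hS] at h1
  rw [h1]
  refine setIntegral_congr_fun hSm fun z _ => ?_
  rw [abs_det_fderiv_shear (hL z) he hL1]

/-- **Integrability transport under the axial shear on an invariant set**: `g` is integrable on a measurable
`S ⊇ tsupport h` iff `z ↦ (1 − Dh_z e) • g(Ψ_h z)` is. [cite: EvansGariepy1992, §3.3.3 Theorem 2] -/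
theorem integrableOn_iff_integrableOn_shear {F : Type*} [NormedAddCommGroup F] [NormedSpace ℝ F]
    (hd : Differentiable ℝ h) (hL : ∀ z, ‖fderiv ℝ h z‖ ≤ L) (he : ‖e‖ ≤ 1) (hL1 : L < 1)
    {S : Set E} (hSm : MeasurableSet S) (hS : tsupport h ⊆ S) (g : E → F) :
    IntegrableOn g S μ ↔ IntegrableOn (fun z => (1 - fderiv ℝ h z e) • g (z - h z • e)) S μ := by
  haveI : CompleteSpace E := FiniteDimensional.complete ℝ E
  have hL0 : 0 ≤ L := (norm_nonneg _).trans (hL 0)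
  have hbij := shear_bijective hd hL he hL0 hL1
  have h1 := integrableOn_image_iff_integrableOn_abs_det_fderiv_smul μ hSm
    (fun z _ => (hasFDerivAt_shear (hd z)).hasFDerivWithinAt) hbij.1.injOn g
  rw [image_eq_of_tsupport_subset hbij hS] at h1
  rw [h1]
  refine integrableOn_congr_fun (fun z _ => ?_) hSm
  rw [abs_det_fderiv_shear (hL z) he hL1]

/-- **Pull-back form**: for `Φ` the inverse shear and a measurable `S ⊇ tsupport h`,
`∫_S g(Φ x) dx = ∫_S (1 − Dh_z e) • g z dz`. [cite: EvansGariepy1992, §3.3.3 Theorem 2] -/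
theorem setIntegral_comp_inverse_eq {F : Type*} [NormedAddCommGroup F] [NormedSpace ℝ F]
    (hd : Differentiable ℝ h) (hL : ∀ z, ‖fderiv ℝ h z‖ ≤ L) (he : ‖e‖ ≤ 1) (hL1 : L < 1)
    {Φ : E → E} (hΦl : LeftInverse Φ (fun z : E => z - h z • e))
    {S : Set E} (hSm : MeasurableSet S) (hS : tsupport h ⊆ S) (g : E → F) :
    ∫ x in S, g (Φ x) ∂μ = ∫ z in S, (1 - fderiv ℝ h z e) • g z ∂μ := by
  rw [setIntegral_eq_setIntegral_shear μ hd hL he hL1 hSm hS (fun x => g (Φ x))]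
  refine setIntegral_congr_fun hSm fun z _ => ?_
  have := hΦl z
  simp only at this
  rw [this]

/-- **Pull-back form of the integrability transport**: `x ↦ g(Φ x)` is integrable on a measurable `S ⊇ tsupport h`
iff `z ↦ (1 − Dh_z e) • g z` is. [cite: EvansGariepy1992, §3.3.3 Theorem 2] -/
theorem integrableOn_comp_inverse_iff {F : Type*} [NormedAddCommGroup F] [NormedSpace ℝ F]
    (hd : Differentiable ℝ h) (hL : ∀ z, ‖fderiv ℝ h z‖ ≤ L) (he : ‖e‖ ≤ 1) (hL1 : L < 1)
    {Φ : E → E} (hΦl : LeftInverse Φ (fun z : E => z - h z • e))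
    {S : Set E} (hSm : MeasurableSet S) (hS : tsupport h ⊆ S) (g : E → F) :
    IntegrableOn (fun x => g (Φ x)) S μ ↔ IntegrableOn (fun z => (1 - fderiv ℝ h z e) • g z) S μ := by
  rw [integrableOn_iff_integrableOn_shear μ hd hL he hL1 hSm hS (fun x => g (Φ x))]
  refine integrableOn_congr_fun (fun z _ => ?_) hSm
  have := hΦl z
  simp only at this
  rw [this]

end Summit.QuantumFields.YangMills.Theorems.PoincareLipschitzAxialShear

end
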